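import Literature.Probability.RandomPlanarGeometry.LoewnerHullCocycle
import Literature.Probability.RandomPlanarGeometry.LoewnerDriverStability
import Literature.Probability.RandomPlanarGeometry.SlitLoewnerNested
import Mathlib.Topology.CompactOpen
import HarnessLib

/-!
# Locality of the Loewner transform in the driver, and delayed drivers `u ↦ U (u ∸ t)`

Topic `Literature/Probability/RandomPlanarGeometry` (deterministic chordal Loewner chains in `ℍ`,
continuous driving functions; Lawler (2005), Ch. 4 §4.1, Rem. 4.9). Two groups of results:

* **Locality** (`Loewner.lt_swallowingTime_and_map_eq_of_eqOn`, `Loewner.map_eq_map_of_eqOn`,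
  `Loewner.domain_eq_domain_of_eqOn`; the hulls: `Loewner.hull_eq_hull_of_eqOn` of
  `SlitLoewnerNested.lean`): the maps and domains at time `t` only depend on the driving function on
  `[0, t]` (the ODE up to time `t`; in the tree this is the case `ω = 0` of the stability estimate
  `Loewner.dist_map_le_of_driving_close`).
* **Delayed drivers** `Loewner.delay t U = U ∘ (· ∸ t)` (constant `U 0` on `[0, t]`, then `U` shifted
  by `t`): continuity, the identities `delay t U (t + u) = U u`, the chain on `[0, t]` is the chain of
  the constant driver `U 0` (a vertical slit at `U 0`), and the COCYCLE at later times
  (`Loewner.map_delay_add`, `Loewner.mem_domain_delay_add_iff`, `Loewner.hull_delay_add_sdiff`):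
  `g^{delay}_{t+u} = g^U_u ∘ g^{const}_t`, `K^{delay}_{t+u} ∖ K^{const}_t = f^{const}_t (K^U_u)` —
  Lawler's `g_{s+t} = g_{s,s+t} ∘ g_s` for the concatenation of a constant driver with `U`; finally
  the delayed driver as a point of `C(ℝ≥0, ℝ)` depends continuously on `(t, U)`
  (`Loewner.continuous_delayCM`), and `delay s (U (s + ·)) = U (· ∨ s)` is the driver frozen
  before `s` (`Loewner.delay_shift_eq_max`).

This is the bookkeeping of the "fake initial slit" construction: a lattice interface whose
microscopic beginning is replaced by a vertical slit of the same capacity `t` is driven by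
`delay t U`, `U` the conjugated driver of the later growth.

## References

* G. F. Lawler, *Conformally Invariant Processes in the Plane*, AMS (2005), Ch. 4 §4.1, Rem. 4.9
  [Lawler2005].
-/

noncomputable section

open Set Filter Topology Metric Complex
open UpperHalfPlane (upperHalfPlaneSet isOpen_upperHalfPlaneSet)
open scoped NNReal

namespace Literature.Probability.RandomPlanarGeometry

namespace Loewner

variable {W W' : ℝ≥0 → ℝ} {z : ℂ}

/-! ### Locality of the Loewner transform in the driving function -/

/-- **Locality**: if two continuous driving functions agree on `[0, t]` and `z` flows beyond `t` for
`W`, then it flows beyond `t` for `W'` and the maps agree at every time `s ≤ t`.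
[cite: Lawler2005, Ch. 4 §4.1] -/
theorem lt_swallowingTime_and_map_eq_of_eqOn (hW : Continuous W) (hW' : Continuous W') {t : ℝ≥0}
    (h : ∀ s : ℝ≥0, s ≤ t → W s = W' s) (hz : (t : WithTop ℝ≥0) < swallowingTime W z) :
    (t : WithTop ℝ≥0) < swallowingTime W' z ∧ ∀ s : ℝ≥0, s ≤ t → map W' s z = map W s z := by
  have hz0 : z ≠ W 0 := ne_driving_of_lt_swallowingTime hz
  obtain ⟨g, hg⟩ := exists_isSolution_swallowingTime_holds hW hz0
  obtain ⟨δ, hδ, hfar⟩ := hg.exists_le_norm_sub hW (b := t) t.coe_nonneg (by simpa using hz)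
  have hfar' : ∀ s : ℝ≥0, s ≤ t → (δ : ℝ) ≤ ‖map W s z - W s‖ := by
    intro s hs
    have hsT : (s : WithTop ℝ≥0) < swallowingTime W z := lt_of_le_of_lt (WithTop.coe_le_coe.2 hs) hz
    have := hfar s ⟨s.coe_nonneg, NNReal.coe_le_coe.2 hs⟩
    rwa [Real.toNNReal_coe, ← map_eq_of_isSolution hW hg hsT] at this
  have key := dist_map_le_of_driving_close (z' := z) hW hW' hz hδ hfar' le_rfl (by positivity)
    (fun s hs ↦ by rw [h s hs, sub_self, abs_zero]) (by
      simp only [dist_self, zero_mul, zero_add]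
      positivity)
  refine ⟨key.1, fun s hs ↦ ?_⟩
  have := key.2 s hs
  simp only [dist_self, zero_mul, zero_add] at this
  exact dist_le_zero.1 this

/-- Locality of the swallowing condition. [cite: Lawler2005, Ch. 4 §4.1] -/
theorem lt_swallowingTime_iff_of_eqOn (hW : Continuous W) (hW' : Continuous W') {t : ℝ≥0}
    (h : ∀ s : ℝ≥0, s ≤ t → W s = W' s) :
    (t : WithTop ℝ≥0) < swallowingTime W z ↔ (t : WithTop ℝ≥0) < swallowingTime W' z :=
  ⟨fun hz ↦ (lt_swallowingTime_and_map_eq_of_eqOn hW hW' h hz).1,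
    fun hz ↦ (lt_swallowingTime_and_map_eq_of_eqOn hW' hW (fun s hs ↦ (h s hs).symm) hz).1⟩

/-- **Locality of the domains**: `H^W_t = H^{W'}_t` if `W = W'` on `[0, t]`. [cite: Lawler2005, Ch. 4 §4.1] -/
theorem domain_eq_domain_of_eqOn (hW : Continuous W) (hW' : Continuous W') {t : ℝ≥0}
    (h : ∀ s : ℝ≥0, s ≤ t → W s = W' s) : domain W t = domain W' t := by
  ext z
  rw [mem_domain_iff, mem_domain_iff, lt_swallowingTime_iff_of_eqOn hW hW' h]

/-- **Locality of the maps** on the domain: `g^W_t = g^{W'}_t` on `H_t` if `W = W'` on `[0, t]`.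
[cite: Lawler2005, Ch. 4 §4.1] -/
theorem map_eq_map_of_eqOn (hW : Continuous W) (hW' : Continuous W') {t : ℝ≥0}
    (h : ∀ s : ℝ≥0, s ≤ t → W s = W' s) (hz : z ∈ domain W t) : map W' t z = map W t z :=
  ((lt_swallowingTime_and_map_eq_of_eqOn hW hW' h ((mem_domain_iff W t z).1 hz).2).2 t le_rfl)

/-! ### Delayed drivers -/

/-- **The driver `U` delayed by `t`**: `u ↦ U (u ∸ t)` — constant `U 0` on `[0, t]`, then `U`
shifted by `t`. [folklore] -/
def delay (t : ℝ≥0) (U : ℝ≥0 → ℝ) : ℝ≥0 → ℝ := fun u ↦ U (u - t)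

variable {U : ℝ≥0 → ℝ} {t : ℝ≥0}

/-- Unfolding. [folklore] -/
theorem delay_apply (t : ℝ≥0) (U : ℝ≥0 → ℝ) (u : ℝ≥0) : delay t U u = U (u - t) := rfl

/-- On `[0, t]` the delayed driver is the constant `U 0`. [folklore] -/
theorem delay_of_le {u : ℝ≥0} (hu : u ≤ t) : delay t U u = U 0 := by
  rw [delay_apply, tsub_eq_zero_of_le hu]

/-- `delay t U (t + u) = U u`. [folklore] -/
@[simp] theorem delay_add (t : ℝ≥0) (U : ℝ≥0 → ℝ) (u : ℝ≥0) : delay t U (t + u) = U u := by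
  rw [delay_apply, add_tsub_cancel_left]

/-- The shifted delayed driver is `U`. [folklore] -/
theorem shift_delay (t : ℝ≥0) (U : ℝ≥0 → ℝ) : (fun u ↦ delay t U (t + u)) = U :=
  funext (delay_add t U)

/-- A delayed continuous driver is continuous. [folklore] -/
theorem continuous_delay (t : ℝ≥0) (hU : Continuous U) : Continuous (delay t U) :=
  hU.comp (continuous_id.sub continuous_const)

/-- **`delay s (U (s + ·)) = U (· ∨ s)`**: delaying the shifted driver freezes `U` before `s`.
[folklore] -/
theorem delay_shift_eq_max (s : ℝ≥0) (U : ℝ≥0 → ℝ) :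
    delay s (fun u ↦ U (s + u)) = fun u ↦ U (max u s) := by
  funext u
  rw [delay_apply, add_tsub_eq_max, max_comm]

/-! ### The chain of a delayed driver -/

/-- On `[0, t]` the chain of the delayed driver is the chain of the constant driver `U 0`: the
hulls agree. [cite: Lawler2005, Ch. 4 §4.1] -/
theorem hull_delay_of_le (hU : Continuous U) {s : ℝ≥0} (hs : s ≤ t) :
    hull (delay t U) s = hull (fun _ ↦ U 0) s :=
  hull_eq_hull_of_eqOn (continuous_delay t hU) continuous_const fun _ hu ↦ delay_of_le (hu.trans hs)

/-- On `[0, t]` the domains agree with those of the constant driver `U 0`. [cite: Lawler2005, Ch. 4 §4.1] -/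
theorem domain_delay_of_le (hU : Continuous U) {s : ℝ≥0} (hs : s ≤ t) :
    domain (delay t U) s = domain (fun _ ↦ U 0) s :=
  domain_eq_domain_of_eqOn (continuous_delay t hU) continuous_const fun _ hu ↦ delay_of_le (hu.trans hs)

/-- On `[0, t]` the maps agree with those of the constant driver `U 0` (on the domain).
[cite: Lawler2005, Ch. 4 §4.1] -/
theorem map_delay_of_le (hU : Continuous U) {s : ℝ≥0} (hs : s ≤ t)
    (hz : z ∈ domain (fun _ ↦ U 0) s) : map (delay t U) s z = map (fun _ ↦ U 0) s z :=
  map_eq_map_of_eqOn continuous_const (continuous_delay t hU)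
    (fun _ hu ↦ (delay_of_le (hu.trans hs)).symm) hz

/-- **The cocycle for the delayed driver, domains**: `z ∈ H^{delay}_{t+u}` iff `z ∈ H^{const}_t` and
`g^{const}_t z ∈ H^U_u`. [cite: Lawler2005, Rem. 4.9] -/
theorem mem_domain_delay_add_iff (hU : Continuous U) (u : ℝ≥0) :
    z ∈ domain (delay t U) (t + u) ↔
      z ∈ domain (fun _ ↦ U 0) t ∧ map (fun _ ↦ U 0) t z ∈ domain U u := by
  rw [mem_domain_add_iff (continuous_delay t hU), shift_delay, domain_delay_of_le hU le_rfl]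
  constructor
  · rintro ⟨hz, h⟩
    exact ⟨hz, by rwa [map_delay_of_le hU le_rfl hz] at h⟩
  · rintro ⟨hz, h⟩
    exact ⟨hz, by rwa [map_delay_of_le hU le_rfl hz]⟩

/-- **The cocycle for the delayed driver, maps**: for `z ∈ H^{const}_t` with `g^{const}_t z ∈ H^U_u`,
`g^{delay t U}_{t+u}(z) = g^U_u (g^{const}_t z)`. [cite: Lawler2005, Rem. 4.9] -/
theorem map_delay_add (hU : Continuous U) {u : ℝ≥0} (hz : z ∈ domain (fun _ ↦ U 0) t)
    (hu : map (fun _ ↦ U 0) t z ∈ domain U u) :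
    map (delay t U) (t + u) z = map U u (map (fun _ ↦ U 0) t z) := by
  have hd : z ∈ domain (delay t U) (t + u) := (mem_domain_delay_add_iff hU u).2 ⟨hz, hu⟩
  have h := (map_add (continuous_delay t hU) ((mem_domain_iff _ _ _).1 hd).2).2
  rw [h, shift_delay, map_delay_of_le hU le_rfl hz]

/-- **The cocycle for the delayed driver, hulls**: `K^{delay t U}_{t+u} ∖ K^{const}_t` is the image
of `K^U_u` under the backward map of the constant driver at time `t`. [cite: Lawler2005, Rem. 4.9] -/
theorem hull_delay_add_sdiff (hU : Continuous U) (u : ℝ≥0) :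
    hull (delay t U) (t + u) \ hull (fun _ ↦ U 0) t = loewnerInv (delay t U) t '' hull U u := by
  rw [← hull_delay_of_le hU le_rfl, hull_add_sdiff_eq_image (continuous_delay t hU), shift_delay]

/-! ### Continuity of `(t, U) ↦ delay t U` on path space -/

/-- `(t, u) ↦ u ∸ t` as a continuous map of `u` depending continuously on `t`. [folklore] -/
def tsubCM : C(ℝ≥0, C(ℝ≥0, ℝ≥0)) :=
  ContinuousMap.curry ⟨fun p : ℝ≥0 × ℝ≥0 ↦ p.2 - p.1, continuous_snd.sub continuous_fst⟩

/-- Unfolding `tsubCM`. [folklore] -/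
@[simp] theorem tsubCM_apply (t u : ℝ≥0) : tsubCM t u = u - t := rfl

/-- **The delayed driver as a point of path space**: `delayCM t U = U ∘ (· ∸ t)`. [folklore] -/
def delayCM (t : ℝ≥0) (U : C(ℝ≥0, ℝ)) : C(ℝ≥0, ℝ) := U.comp (tsubCM t)

/-- `delayCM` is `delay` on functions. [folklore] -/
@[simp] theorem delayCM_apply (t : ℝ≥0) (U : C(ℝ≥0, ℝ)) (u : ℝ≥0) : delayCM t U u = delay t U u := rfl

/-- Coercion form. [folklore] -/
theorem coe_delayCM (t : ℝ≥0) (U : C(ℝ≥0, ℝ)) : ⇑(delayCM t U) = delay t U := rfl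

/-- **`(t, U) ↦ delay t U` is jointly continuous** on `ℝ≥0 × C(ℝ≥0, ℝ)` (composition is jointly
continuous for locally compact middle space). [folklore] -/
theorem continuous_delayCM : Continuous fun p : ℝ≥0 × C(ℝ≥0, ℝ) ↦ delayCM p.1 p.2 := by
  have h1 : Continuous fun p : ℝ≥0 × C(ℝ≥0, ℝ) ↦ (tsubCM p.1, p.2) :=
    (tsubCM.continuous.comp continuous_fst).prodMk continuous_snd
  exact ContinuousMap.continuous_comp'.comp h1

end Loewner

end Literature.Probability.RandomPlanarGeometry

end
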